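import Literature.NumberTheory.EllipticCurves.ShaPrimaryLevelProfile
import Literature.NumberTheory.EllipticCurves.BSDRankZeroDensityProofs
import HarnessLib

/-!
# The level profile in SELMER currency: `#Sel^{(p^e)}(E/K) = p^{e(r + t_p) + 2 m_e} · #E(K)[p^e]`, and the
# second-descent CERTIFICATE (two consecutive Selmer counts whose growth is the number of known points
# give the rank and close the door)

Topic `Literature/NumberTheory/EllipticCurves`, family `bsd`. Theorems only (no definition, no named fact;
D-0026). A complete `n`-descent computes `#Sel^{(n)}(E/K)`, not `#Ш(E/K)[n]`; the two are related by the
tree's PROVED descent count `#Sel^{(n)} = n^{rank E(K)} · #E(K)[n] · #Ш[n]` (Silverman X.4.2(a),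
`WeierstrassCurve.natCard_selmerGroup_eq`). This file restates the level profile of `Ш(E/K)[p^∞]`
(`ShaPrimaryLevelProfile`: `#Ш[p^e] = p^{e·t_p + 2 m_e}`) in the currency a descent actually outputs, for an
elliptic curve over a number field `K`, a prime `p`, `r = rank E(K)`, `t_p = corank_{ℤ_p} Ш(E/K)[p^∞]`:

* §1 `natCard_selmerGroup_pow_eq`: `#Sel^{(p^e)} = p^{e r} · #E(K)[p^e] · #Ш[p^e]` (no pairing);
  `exists_selmer_levelProfile` (granting Cassels–Tate `hCT`): **`#Sel^{(p^e)}(E/K) = p^{e(r + t_p) + 2 m_e} ·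
  #E(K)[p^e]`** with `m` monotone, `m 0 = 0`, eventually constant.
* §2 TWO CONSECUTIVE DESCENTS, written with exponents `#Sel^{(p^e)} = p^a`, `#Sel^{(p^{e+1})} = p^b`,
  `#E(K)[p^e] = p^c`, `#E(K)[p^{e+1}] = p^d` and the *growth* `g = (b − d) − (a − c)`:
  - no pairing: `g ≥ r` (`rank_le_selmer_growth`) — each further descent grows by at least the rank;
  - **THE SECOND-DESCENT CERTIFICATE** (no pairing; this is what mwrank's second descent certifies): if `r₀`
    independent points are known (`r₀ ≤ r`) and the growth is exactly `r₀`, then **`rank E(K) = r₀`,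
    `Ш(E/K)[p^∞] = Ш(E/K)[p^e]` and `t_p(E) = 0`** (`rank_eq_and_shaCorank_eq_zero_of_selmer_growth_eq`); e.g.
    `e = 1`, `p = 2`: a `2`-descent, a `4`-descent and `r₀` points with `g = r₀` prove `rank = r₀` and
    `Ш[2^∞] = Ш[2]` of order `2^{a − c − r₀}` (`natCard_sha_torsionBy_of_selmer_growth_eq`);
  - granting Cassels–Tate: `g = r + t_p + 2j` (`exists_selmer_growth_eq`), so **`r + t_p ≤ g`** and
    `r + t_p ≡ g (mod 2)` (`rank_add_shaCorank_le_selmer_growth`): two consecutive descents bound rank PLUS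
    corank from above by their growth (one descent bounds it by `a − c`, Silverman X.4.2; tree
    `exists_selmerRank_eq_add`).

Nothing here proves the finiteness of `Ш`.

## References

* J. H. Silverman, *The Arithmetic of Elliptic Curves*, 2nd ed. (2009), Thm. X.4.2 (the descent count),
  X.4.14 (the pairing). [SilvermanAEC2009]
* J. E. Cremona, *Algorithms for Modular Elliptic Curves*, 2nd ed. (1997), §3.6 (second descent in mwrank:
  "if the second descent shows that no element of `Ш[2]` lifts, the rank is determined"). [Cremona1997Algorithms]
* T. Dokchitser, *Notes on the parity conjecture* (2013), §2. [Dokchitser2013ParityNotes]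
* R. Greenberg, LNM 1716 (1999), §1, pp. 54–57. [Greenberg1999LNM]
-/

noncomputable section

open scoped Classical
open scoped AddSubgroup
open Literature.Algebra.Module

namespace Literature.NumberTheory.EllipticCurves

universe u

open WeierstrassCurve

variable {K : Type u} [Field K] [NumberField K] (W : WeierstrassCurve K) [W.IsElliptic]
  (p : ℕ) [hp : Fact p.Prime]

/-! ### §1 The descent count at level `p^e` and the Selmer level profile -/

/-- **`#Sel^{(p^e)}(E/K) = p^{e·r} · #E(K)[p^e] · #Ш(E/K)[p^e]`** (Silverman X.4.2(a), tree
`natCard_selmerGroup_eq`, with `#(Ш ⊓ H¹[n]) = #Ш[n]`). [cite: SilvermanAEC2009, Thm. X.4.2(a)] -/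
theorem natCard_selmerGroup_pow_eq (e : ℕ) :
    Nat.card (W.selmerGroup ((p ^ e : ℕ) : ℤ)) = p ^ (e * W.mordellWeilRank) *
      Nat.card (W.toAffine.Point[((p ^ e : ℕ) : ℤ)]) * Nat.card (W.sha[((p ^ e : ℕ) : ℤ)]) := by
  rw [W.natCard_selmerGroup_eq (pow_pos hp.out.pos e).ne', natCard_torsionBy_addSubgroup, ← pow_mul]

/-- **The Selmer level profile** (granting Cassels–Tate): `#Sel^{(p^e)}(E/K) = p^{e(r + t_p) + 2 m_e} · #E(K)[p^e]`
for every `e`, with `m 0 = 0`, `m` monotone and eventually constant. [cite: SilvermanAEC2009, Thm. X.4.2(a)]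
[cite: Dokchitser2013ParityNotes, §2] -/
theorem exists_selmer_levelProfile (hCT : exists_casselsTate_pairing (K := K)) :
    ∃ m : ℕ → ℕ, m 0 = 0 ∧ Monotone m ∧ (∃ e₀ : ℕ, ∀ e, e₀ ≤ e → m e = m e₀) ∧
      ∀ e : ℕ, Nat.card (W.selmerGroup ((p ^ e : ℕ) : ℤ)) =
        p ^ (e * (W.mordellWeilRank + W.shaCorank p) + 2 * m e) * Nat.card (W.toAffine.Point[((p ^ e : ℕ) : ℤ)]) := by
  obtain ⟨m, h0, hmono, hev, h⟩ := exists_sha_levelProfile W p hCT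
  refine ⟨m, h0, hmono, hev, fun e ↦ ?_⟩
  rw [natCard_selmerGroup_pow_eq W p e, h e]
  ring

/-! ### §2 Two consecutive descents -/

/-- The growth identity behind two consecutive descents (no pairing): with `#Sel^{(p^e)} = p^a`,
`#Sel^{(p^{e+1})} = p^b`, `#E(K)[p^e] = p^c`, `#E(K)[p^{e+1}] = p^d`, `#Ш[p^e] = p^α`, `#Ш[p^{e+1}] = p^β`:
`a = e r + c + α` and `b = (e+1) r + d + β`. [cite: SilvermanAEC2009, Thm. X.4.2(a)] -/
theorem selmer_exponent_eq {e a c α : ℕ} (ha : Nat.card (W.selmerGroup ((p ^ e : ℕ) : ℤ)) = p ^ a)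
    (hc : Nat.card (W.toAffine.Point[((p ^ e : ℕ) : ℤ)]) = p ^ c)
    (hα : Nat.card (W.sha[((p ^ e : ℕ) : ℤ)]) = p ^ α) : a = e * W.mordellWeilRank + c + α := by
  have h := natCard_selmerGroup_pow_eq W p e
  rw [ha, hc, hα, ← pow_add, ← pow_add] at h
  exact Nat.pow_right_injective hp.out.two_le h

/-- `#Ш(E/K)[p^e]` is a power of `p` (it is a finite `p`-group). [cite: SilvermanAEC2009, Thm. X.4.2(b)] -/
theorem exists_natCard_sha_torsionBy_pow_eq_pow (e : ℕ) : ∃ α : ℕ, Nat.card (W.sha[((p ^ e : ℕ) : ℤ)]) = p ^ α := by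
  haveI := finite_sha_torsionBy_pow W p e
  exact exists_natCard_eq_prime_pow_of_primary p fun x ↦ ⟨e, Subtype.ext (by
    rw [AddSubgroupClass.coe_nsmul, ZeroMemClass.coe_zero]; exact AddSubgroup.torsionBy.nsmul_iff.mp x.2)⟩

/-- **Each further descent grows by at least the rank** (no pairing): with the exponents as above,
`a − c ≤ b − d` holds in the form `a + d + r ≤ b + c`, i.e. the growth `(b − d) − (a − c)` is `≥ r = rank E(K)`
(because `Ш[p^e] ≤ Ш[p^{e+1}]`). [cite: SilvermanAEC2009, Thm. X.4.2(a)] -/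
theorem rank_le_selmer_growth {e a b c d : ℕ} (ha : Nat.card (W.selmerGroup ((p ^ e : ℕ) : ℤ)) = p ^ a)
    (hb : Nat.card (W.selmerGroup ((p ^ (e + 1) : ℕ) : ℤ)) = p ^ b)
    (hc : Nat.card (W.toAffine.Point[((p ^ e : ℕ) : ℤ)]) = p ^ c)
    (hd : Nat.card (W.toAffine.Point[((p ^ (e + 1) : ℕ) : ℤ)]) = p ^ d) :
    a + d + W.mordellWeilRank ≤ b + c := by
  obtain ⟨α, hα⟩ := exists_natCard_sha_torsionBy_pow_eq_pow W p e
  obtain ⟨β, hβ⟩ := exists_natCard_sha_torsionBy_pow_eq_pow W p (e + 1)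
  have h1 := selmer_exponent_eq W p ha hc hα
  have h2 := selmer_exponent_eq W p hb hd hβ
  -- `α ≤ β`: `Ш[p^e] ≤ Ш[p^{e+1}]`
  haveI := finite_sha_torsionBy_pow W p (e + 1)
  have hαβ : α ≤ β := by
    rw [← Nat.pow_le_pow_iff_right hp.out.one_lt, ← hα, ← hβ]
    exact AddSubgroup.card_le_of_le (torsionBy_pow_mono (X := W.sha) p (Nat.le_succ e))
  rw [h1, h2]; ring_nf; omega

/-- **THE SECOND-DESCENT CERTIFICATE** (no pairing). If `r₀ ≤ rank E(K)` (e.g. `r₀` independent points are known)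
and two consecutive descents grow by exactly `r₀` — `#Sel^{(p^e)} = p^a`, `#Sel^{(p^{e+1})} = p^b`, `#E(K)[p^e] = p^c`,
`#E(K)[p^{e+1}] = p^d` with `b + c = a + d + r₀` — then **`rank E(K) = r₀`, `Ш(E/K)[p^∞] = Ш(E/K)[p^e]` and
`t_p(E) = 0`**. For `p = 2`, `e = 1` this is the certificate of a `2`-descent followed by a `4`-descent (Cremona,
*Algorithms*, §3.6). [cite: Cremona1997Algorithms, §3.6 (second descent)] [cite: SilvermanAEC2009, Thm. X.4.2(a)] -/
theorem rank_eq_and_shaCorank_eq_zero_of_selmer_growth_eq {e a b c d r₀ : ℕ} (hr₀ : r₀ ≤ W.mordellWeilRank)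
    (ha : Nat.card (W.selmerGroup ((p ^ e : ℕ) : ℤ)) = p ^ a)
    (hb : Nat.card (W.selmerGroup ((p ^ (e + 1) : ℕ) : ℤ)) = p ^ b)
    (hc : Nat.card (W.toAffine.Point[((p ^ e : ℕ) : ℤ)]) = p ^ c)
    (hd : Nat.card (W.toAffine.Point[((p ^ (e + 1) : ℕ) : ℤ)]) = p ^ d) (hg : b + c = a + d + r₀) :
    W.mordellWeilRank = r₀ ∧ AddCommGroup.primaryComponent W.sha p = W.sha[((p ^ e : ℕ) : ℤ)] ∧
      W.shaCorank p = 0 := by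
  obtain ⟨α, hα⟩ := exists_natCard_sha_torsionBy_pow_eq_pow W p e
  obtain ⟨β, hβ⟩ := exists_natCard_sha_torsionBy_pow_eq_pow W p (e + 1)
  have h1 := selmer_exponent_eq W p ha hc hα
  have h2 := selmer_exponent_eq W p hb hd hβ
  haveI := finite_sha_torsionBy_pow W p (e + 1)
  have hαβ : α ≤ β := by
    rw [← Nat.pow_le_pow_iff_right hp.out.one_lt, ← hα, ← hβ]
    exact AddSubgroup.card_le_of_le (torsionBy_pow_mono (X := W.sha) p (Nat.le_succ e))
  have hrank : W.mordellWeilRank = r₀ := by rw [h1, h2] at hg; ring_nf at hg; omega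
  have hab : β = α := by rw [h1, h2, hrank] at hg; ring_nf at hg; omega
  have hst : Nat.card (W.sha[((p ^ (e + 1) : ℕ) : ℤ)]) = Nat.card (W.sha[((p ^ e : ℕ) : ℤ)]) := by
    rw [hα, hβ, hab]
  exact ⟨hrank, primaryComponent_sha_eq_torsionBy_of_natCard_succ_eq W p hst,
    shaCorank_eq_zero_of_natCard_sha_torsionBy_pow_succ_eq W p hst⟩

/-- Under the second-descent certificate the order of the (complete, finite) `p`-primary component is read off
the first of the two descents: `#Ш(E/K)[p^∞] = #Ш(E/K)[p^e] = p^{a − c − e·r₀}`. [cite: SilvermanAEC2009, Thm. X.4.2(a)]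
[cite: Cremona1997Algorithms, §3.6 (second descent)] -/
theorem natCard_sha_torsionBy_of_selmer_growth_eq {e a b c d r₀ : ℕ} (hr₀ : r₀ ≤ W.mordellWeilRank)
    (ha : Nat.card (W.selmerGroup ((p ^ e : ℕ) : ℤ)) = p ^ a)
    (hb : Nat.card (W.selmerGroup ((p ^ (e + 1) : ℕ) : ℤ)) = p ^ b)
    (hc : Nat.card (W.toAffine.Point[((p ^ e : ℕ) : ℤ)]) = p ^ c)
    (hd : Nat.card (W.toAffine.Point[((p ^ (e + 1) : ℕ) : ℤ)]) = p ^ d) (hg : b + c = a + d + r₀) :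
    Nat.card (AddCommGroup.primaryComponent W.sha p) = p ^ (a - c - e * r₀) ∧
      Nat.card (W.sha[((p ^ e : ℕ) : ℤ)]) = p ^ (a - c - e * r₀) := by
  obtain ⟨hrank, hT, -⟩ := rank_eq_and_shaCorank_eq_zero_of_selmer_growth_eq W p hr₀ ha hb hc hd hg
  obtain ⟨α, hα⟩ := exists_natCard_sha_torsionBy_pow_eq_pow W p e
  have h1 := selmer_exponent_eq W p ha hc hα
  have hαeq : α = a - c - e * r₀ := by rw [hrank] at h1; omega
  refine ⟨?_, by rw [hα, hαeq]⟩
  rw [congrArg (fun H : AddSubgroup W.sha ↦ Nat.card H) hT, hα, hαeq]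

/-- **Two consecutive descents grow by `r + t_p + 2j`** (granting Cassels–Tate): with the exponents as above,
`b + c = a + d + (r + t_p + 2j)` for some `j`. [cite: Dokchitser2013ParityNotes, §2] [cite: SilvermanAEC2009, Thm. X.4.2(a)] -/
theorem exists_selmer_growth_eq (hCT : exists_casselsTate_pairing (K := K)) {e a b c d : ℕ}
    (ha : Nat.card (W.selmerGroup ((p ^ e : ℕ) : ℤ)) = p ^ a)
    (hb : Nat.card (W.selmerGroup ((p ^ (e + 1) : ℕ) : ℤ)) = p ^ b)
    (hc : Nat.card (W.toAffine.Point[((p ^ e : ℕ) : ℤ)]) = p ^ c)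
    (hd : Nat.card (W.toAffine.Point[((p ^ (e + 1) : ℕ) : ℤ)]) = p ^ d) :
    ∃ j : ℕ, b + c = a + d + (W.mordellWeilRank + W.shaCorank p + 2 * j) := by
  obtain ⟨α, hα⟩ := exists_natCard_sha_torsionBy_pow_eq_pow W p e
  obtain ⟨j, hj⟩ := exists_natCard_sha_torsionBy_pow_succ_eq W p hCT e
  have hβ : Nat.card (W.sha[((p ^ (e + 1) : ℕ) : ℤ)]) = p ^ (W.shaCorank p + 2 * j + α) := by
    rw [hj, hα, ← pow_add]
  have h1 := selmer_exponent_eq W p ha hc hα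
  have h2 := selmer_exponent_eq W p hb hd hβ
  exact ⟨j, by rw [h1, h2]; ring⟩

/-- **Two consecutive descents bound rank plus corank from above** (granting Cassels–Tate): with the exponents as
above, `r + t_p ≤ (b + c) − (a + d)` and `r + t_p ≡ (b + c) − (a + d) (mod 2)` — versus the one-descent bound
`r + t_p ≤ a − c` of Silverman X.4.2. [cite: Dokchitser2013ParityNotes, §2] [cite: SilvermanAEC2009, Thm. X.4.2(a)] -/
theorem rank_add_shaCorank_le_selmer_growth (hCT : exists_casselsTate_pairing (K := K)) {e a b c d : ℕ}
    (ha : Nat.card (W.selmerGroup ((p ^ e : ℕ) : ℤ)) = p ^ a)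
    (hb : Nat.card (W.selmerGroup ((p ^ (e + 1) : ℕ) : ℤ)) = p ^ b)
    (hc : Nat.card (W.toAffine.Point[((p ^ e : ℕ) : ℤ)]) = p ^ c)
    (hd : Nat.card (W.toAffine.Point[((p ^ (e + 1) : ℕ) : ℤ)]) = p ^ d) :
    W.mordellWeilRank + W.shaCorank p ≤ (b + c) - (a + d) ∧
      (W.mordellWeilRank + W.shaCorank p) % 2 = ((b + c) - (a + d)) % 2 := by
  obtain ⟨j, hj⟩ := exists_selmer_growth_eq W p hCT ha hb hc hd
  omega

/-- **With `r₀` known points, two consecutive descents bound the corank**: `t_p(E) ≤ (b + c) − (a + d) − r₀`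
(granting Cassels–Tate). [cite: Dokchitser2013ParityNotes, §2] -/
theorem shaCorank_le_selmer_growth_sub (hCT : exists_casselsTate_pairing (K := K)) {e a b c d r₀ : ℕ}
    (hr₀ : r₀ ≤ W.mordellWeilRank) (ha : Nat.card (W.selmerGroup ((p ^ e : ℕ) : ℤ)) = p ^ a)
    (hb : Nat.card (W.selmerGroup ((p ^ (e + 1) : ℕ) : ℤ)) = p ^ b)
    (hc : Nat.card (W.toAffine.Point[((p ^ e : ℕ) : ℤ)]) = p ^ c)
    (hd : Nat.card (W.toAffine.Point[((p ^ (e + 1) : ℕ) : ℤ)]) = p ^ d) :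
    W.shaCorank p ≤ (b + c) - (a + d) - r₀ := by
  obtain ⟨j, hj⟩ := exists_selmer_growth_eq W p hCT ha hb hc hd
  omega

end Literature.NumberTheory.EllipticCurves

end
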